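import Summits.ValiantsHypothesis.ValiantsHypothesis.Theorems.LacunarySymmetroidMatrixDescartesCensusTwistedRolle

/-!
# `MatrixDescartes` census — the GENERAL WINDOW BALANCE (any sub-fewnomial of a near-sharp fewnomial balances somewhere)

HONEST FRAMING.  Object-search cell `pub-symmetroid`, route `LacunarySymmetroid`; door-A item `Theses.LacunarySymmetroid.DoorA26`
(stmt-ValiantsHypothesis-19979, `= PosRootLawAt 2 6 19`, OPEN, never asserted).  One elementary theorem about an arbitrary real
polynomial `f`, generalising the tree's three WINDOW balances (`…CensusNineteenFlank`: `flank_balance_low/high_support`,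
`window_balance_mid_support` — four CONSECUTIVE support exponents through the sign repetition) to an ARBITRARY set `W` of support
exponents:

* `exists_twists_coeff` — killing a finite set `U` of exponents by Euler twists `X·g′ − u·g` produces a polynomial `g` with
  `coeff g n = (∏_{u ∈ U} (n − u)) · coeff f n` and costs at most `#U` distinct positive roots (the tree's twisted Rolle
  `card_posRoots_le_card_posRoots_twist_succ`, iterated on the polynomial itself rather than on an indexed fewnomial);
* `window_balance_support` — if `#supp f ≤ #Z₊^{distinct}(f) + #W − 1` and `W ⊆ supp f`, then at some `x > 0`
  `∑_{t ∈ W} f_t · (∏_{u ∈ supp f ∖ W} (t − u)) · x^t = 0` (kill `supp f ∖ W`: one positive root survives, and the twisted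
  polynomial IS this `#W`-nomial);
* `window4_balance_support` — the case `W = {a < b < c < d}` written out with the SIGNED reduced weights
  `∏_{u ∈ supp f} (u ∈ W ? 1 : (t − u))` (hypothesis `#supp f ≤ #Z₊ + 3`, NO consecutiveness), and the bookkeeping lemma
  `prod_ite4_sub_eq_negOnePow_mul_natCast` turning such a signed weight into `(−1)^m · N` with `m`, `N` decidable naturals, so that
  an emitter can continue with the tree's `flank_amgm_row` exactly as for the consecutive windows.

WHY (val-sym-door-p5 g5, 2026-08-27): for a door-A Case-A cell (21 non-zero coefficients, one repetition, 19 distinct positive roots)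
EVERY 4-set `W` with positions on both sides of the repetition gives a balance; when the twisted sign pattern has a lone term this
yields AM–GM rows with `W`-reduced weights — for `W = {z} ∪ {a<b<c}` (`z` across the repetition) the row through `(a,b,c)` is the
C25a Newton row with the gap factors `|· − z|` deleted, strictly stronger by concavity of `log`, and the row through `(z,b,c)` is new.
With these rows the five one-open-cell OPEN40 supports' last cells die at the root of the second-pass instrument (located, exact;
kernel replays follow in the position files).  NECESSARY conditions on hypothetical nineteens only; no bound on `ζ_sym(2,6)`,
nothing on `DoorA26` (OPEN), on `MatrixDescartes` (stmt-ValiantsHypothesis-18050) or on `VP ≠ VNP`.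

[folklore] Rolle for `x^{−u} g`; support bookkeeping.
-/

-- `Summit.ValiantsHypothesis.ValiantsHypothesis.…` repeats a component by the D-0017 layout
-- (single-conjunct summit), which the `dupNamespace` linter flags; the name is mandated.
set_option linter.dupNamespace false

namespace Summit.ValiantsHypothesis.ValiantsHypothesis.Theorems.LacunarySymmetroidMatrixDescartes.Census

open Polynomial Finset
open scoped BigOperators Polynomial

/-! ### Iterated Euler twists on a polynomial -/

/-- **Iterated twisted Rolle, coefficient form.**  For every real polynomial `f` and finite set `U` of (real-valued natural)
weights there is a polynomial `g` — the iterated Euler twist of `f` at the weights `u ∈ U` — with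
`coeff g n = (∏_{u ∈ U} (n − u)) · coeff f n` for all `n`, and `#Z₊^{distinct}(f) ≤ #Z₊^{distinct}(g) + #U`. [folklore] -/
theorem exists_twists_coeff (f : ℝ[X]) (U : Finset ℕ) :
    ∃ g : ℝ[X], (∀ n, g.coeff n = (∏ u ∈ U, ((n : ℝ) - u)) * f.coeff n) ∧
      (f.roots.toFinset.filter (fun x => 0 < x)).card ≤ (g.roots.toFinset.filter (fun x => 0 < x)).card + U.card := by
  classical
  induction U using Finset.induction_on with
  | empty => exact ⟨f, fun n => by simp, by simp⟩
  | insert u U hu ih =>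
    obtain ⟨g, hg, hZ⟩ := ih
    refine ⟨X * derivative g - C (u : ℝ) * g, fun n => ?_, ?_⟩
    · rw [coeff_X_mul_derivative_sub_C_mul, hg n, Finset.prod_insert hu]; ring
    · have step := card_posRoots_le_card_posRoots_twist_succ g (u : ℝ)
      rw [Finset.card_insert_of_notMem hu]; omega

/-! ### The general window balance -/

/-- **GENERAL WINDOW BALANCE.**  Let `f ∈ ℝ[X]` and `W ⊆ supp f` with `#supp f ≤ #Z₊^{distinct}(f) + #W − 1` (written
additively).  Killing the exponents of `supp f ∖ W` by Euler twists leaves a `#W`-nomial with at least one positive root, so at some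
`x > 0`:  `∑_{t ∈ W} f_t · (∏_{u ∈ supp f ∖ W} (t − u)) · x^t = 0`.  (For a door-A Case-A nineteen: `#supp = 21`, `Z₊ = 19`, any
`#W ≥ 3`.) [folklore] -/
theorem window_balance_support (f : ℝ[X]) (W : Finset ℕ) (hW : W ⊆ f.support)
    (hZ : f.support.card + 1 ≤ (f.roots.toFinset.filter (fun x => 0 < x)).card + W.card) :
    ∃ x : ℝ, 0 < x ∧ ∑ t ∈ W, f.coeff t * (∏ u ∈ f.support \ W, ((t : ℝ) - u)) * x ^ t = 0 := by
  classical
  obtain ⟨g, hg, hZg⟩ := exists_twists_coeff f (f.support \ W)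
  have hcardU : (f.support \ W).card = f.support.card - W.card := Finset.card_sdiff_of_subset hW
  have hWle : W.card ≤ f.support.card := Finset.card_le_card hW
  have hZpos : 0 < (g.roots.toFinset.filter (fun x => 0 < x)).card := by omega
  obtain ⟨x, hx⟩ := Finset.card_pos.mp hZpos
  rw [Finset.mem_filter, Multiset.mem_toFinset] at hx
  obtain ⟨hxroot, hxpos⟩ := hx
  have hg0 : g ≠ 0 := fun h => by rw [h, roots_zero] at hxroot; exact Multiset.notMem_zero _ hxroot
  have heval : g.eval x = 0 := (mem_roots hg0).mp hxroot |> IsRoot.eq_zero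
  -- `g` is supported on `W`
  have hsuppg : g.support ⊆ W := by
    intro n hn
    rw [mem_support_iff, hg n] at hn
    by_contra hnW
    by_cases hnf : n ∈ f.support
    · have hmem : n ∈ f.support \ W := Finset.mem_sdiff.mpr ⟨hnf, hnW⟩
      exact hn (by rw [Finset.prod_eq_zero hmem (sub_self _), zero_mul])
    · exact hn (by rw [notMem_support_iff.mp hnf, mul_zero])
  refine ⟨x, hxpos, ?_⟩
  rw [eval_eq_sum, sum_def, Finset.sum_subset hsuppg (fun n _ hn => by rw [notMem_support_iff.mp hn, zero_mul])] at heval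
  rw [← heval]
  refine Finset.sum_congr rfl fun t _ => ?_
  rw [hg t]; ring

/-! ### Four exponents, signed reduced weights -/

/-- The signed reduced weight of `t` for the window `{p,q,r,s}` over a finite exponent set, as a product over the whole set with the
window factors set to `1`, equals the product over the set minus the window. [folklore] -/
theorem prod_sdiff4_eq_prod_ite {S : Finset ℕ} {p q r s : ℕ} (hp : p ∈ S) (hq : q ∈ S) (hr : r ∈ S) (hs : s ∈ S) (t : ℕ) :
    ∏ u ∈ S \ {p, q, r, s}, ((t : ℝ) - u) = ∏ u ∈ S, (if u = p ∨ u = q ∨ u = r ∨ u = s then (1 : ℝ) else ((t : ℝ) - u)) := by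
  classical
  have hsub : ({p, q, r, s} : Finset ℕ) ⊆ S := by
    intro u hu; simp only [Finset.mem_insert, Finset.mem_singleton] at hu
    rcases hu with rfl | rfl | rfl | rfl <;> assumption
  have h1 : ∏ u ∈ ({p, q, r, s} : Finset ℕ), (if u = p ∨ u = q ∨ u = r ∨ u = s then (1 : ℝ) else ((t : ℝ) - u)) = 1 := by
    refine Finset.prod_eq_one fun u hu => ?_
    simp only [Finset.mem_insert, Finset.mem_singleton] at hu
    rw [if_pos hu]
  have h2 : ∏ u ∈ S \ {p, q, r, s}, (if u = p ∨ u = q ∨ u = r ∨ u = s then (1 : ℝ) else ((t : ℝ) - u))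
      = ∏ u ∈ S \ {p, q, r, s}, ((t : ℝ) - u) := by
    refine Finset.prod_congr rfl fun u hu => ?_
    have hu' : ¬ (u = p ∨ u = q ∨ u = r ∨ u = s) := by
      intro h; rw [Finset.mem_sdiff] at hu; apply hu.2
      simp only [Finset.mem_insert, Finset.mem_singleton]; exact h
    rw [if_neg hu']
  rw [← Finset.prod_sdiff hsub, h1, mul_one, h2]

/-- **GENERAL FOUR-TERM WINDOW BALANCE, SUPPORT FORM.**  `f ∈ ℝ[X]` with `#supp f ≤ #Z₊^{distinct}(f) + 3` and ANY four support
exponents `a < b < c < d` (no consecutiveness required).  Then at some `x > 0`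
`f_a W_a x^a + f_b W_b x^b + f_c W_c x^c + f_d W_d x^d = 0` with the SIGNED reduced weights
`W_t = ∏_{u ∈ supp f, u ∉ {a,b,c,d}} (t − u)` (window factors written as `1`).  The tree's three consecutive window balances
(`…CensusNineteenFlank`) are the cases `{a,b,c,d}` consecutive through a repetition, after taking signs. [folklore] -/
theorem window4_balance_support (f : ℝ[X])
    (hZ : f.support.card ≤ (f.roots.toFinset.filter (fun x => 0 < x)).card + 3)
    {a b c d : ℕ} (ha : a ∈ f.support) (hb : b ∈ f.support) (hc : c ∈ f.support) (hd : d ∈ f.support)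
    (hab : a < b) (hbc : b < c) (hcd : c < d) :
    ∃ x : ℝ, 0 < x ∧
      f.coeff a * (∏ u ∈ f.support, (if u = a ∨ u = b ∨ u = c ∨ u = d then (1 : ℝ) else ((a : ℝ) - u))) * x ^ a
        + f.coeff b * (∏ u ∈ f.support, (if u = a ∨ u = b ∨ u = c ∨ u = d then (1 : ℝ) else ((b : ℝ) - u))) * x ^ b
        + f.coeff c * (∏ u ∈ f.support, (if u = a ∨ u = b ∨ u = c ∨ u = d then (1 : ℝ) else ((c : ℝ) - u))) * x ^ c
        + f.coeff d * (∏ u ∈ f.support, (if u = a ∨ u = b ∨ u = c ∨ u = d then (1 : ℝ) else ((d : ℝ) - u))) * x ^ d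
        = 0 := by
  classical
  have hab' : a ≠ b := hab.ne
  have hac' : a ≠ c := (hab.trans hbc).ne
  have had' : a ≠ d := ((hab.trans hbc).trans hcd).ne
  have hbc' : b ≠ c := hbc.ne
  have hbd' : b ≠ d := (hbc.trans hcd).ne
  have hcd' : c ≠ d := hcd.ne
  have hW : ({a, b, c, d} : Finset ℕ) ⊆ f.support := by
    intro u hu; simp only [Finset.mem_insert, Finset.mem_singleton] at hu
    rcases hu with rfl | rfl | rfl | rfl <;> assumption
  have hcard : ({a, b, c, d} : Finset ℕ).card = 4 := by
    rw [Finset.card_insert_of_notMem (by simp [hab', hac', had']), Finset.card_insert_of_notMem (by simp [hbc', hbd']),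
      Finset.card_insert_of_notMem (by simp [hcd']), Finset.card_singleton]
  obtain ⟨x, hx, hbal⟩ := window_balance_support f {a, b, c, d} hW (by rw [hcard]; omega)
  refine ⟨x, hx, ?_⟩
  rw [Finset.sum_insert (by simp [hab', hac', had']), Finset.sum_insert (by simp [hbc', hbd']),
    Finset.sum_insert (by simp [hcd']), Finset.sum_singleton,
    prod_sdiff4_eq_prod_ite ha hb hc hd, prod_sdiff4_eq_prod_ite ha hb hc hd, prod_sdiff4_eq_prod_ite ha hb hc hd,
    prod_sdiff4_eq_prod_ite ha hb hc hd] at hbal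
  linear_combination hbal

/-- The SIGNED reduced window weight as `(−1)^m · N` with `m = #{u ∈ S : u ∉ window, t < u}` and `N` the absolute reduced weight as a
natural number — both evaluate by `decide`, so a generated file can rewrite the balance of `window4_balance_support` into numerals.
[folklore] -/
theorem prod_ite4_sub_eq_negOnePow_mul_natCast (S : Finset ℕ) (t p q r s : ℕ) :
    (∏ u ∈ S, (if u = p ∨ u = q ∨ u = r ∨ u = s then (1 : ℝ) else ((t : ℝ) - (u : ℝ))))
      = (-1 : ℝ) ^ (S.filter (fun u => ¬ (u = p ∨ u = q ∨ u = r ∨ u = s) ∧ t < u)).card *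
        ((∏ u ∈ S, (if u = p ∨ u = q ∨ u = r ∨ u = s then 1 else ((t : ℤ) - (u : ℤ)).natAbs) : ℕ) : ℝ) := by
  classical
  induction S using Finset.induction_on with
  | empty => simp
  | insert v S hv ih =>
    rw [Finset.prod_insert hv, Finset.prod_insert hv, Finset.filter_insert, ih]
    by_cases hw : v = p ∨ v = q ∨ v = r ∨ v = s
    · rw [if_pos hw, if_pos hw, if_neg (fun h => h.1 hw)]; push_cast; ring
    · rw [if_neg hw, if_neg hw]
      by_cases htv : t < v
      · rw [if_pos ⟨hw, htv⟩, Finset.card_insert_of_notMem (fun h => hv (Finset.mem_filter.mp h).1), pow_succ]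
        have : (((t : ℤ) - (v : ℤ)).natAbs : ℝ) = (v : ℝ) - t := by
          rw [show ((t : ℤ) - (v : ℤ)).natAbs = v - t by omega]; push_cast [Nat.cast_sub htv.le]; ring
        push_cast; rw [this]; ring
      · rw [if_neg (fun h => htv h.2)]
        have : (((t : ℤ) - (v : ℤ)).natAbs : ℝ) = (t : ℝ) - v := by
          rw [show ((t : ℤ) - (v : ℤ)).natAbs = t - v by omega]; push_cast [Nat.cast_sub (not_lt.mp htv)]; ring
        push_cast; rw [this]; ring

end Summit.ValiantsHypothesis.ValiantsHypothesis.Theorems.LacunarySymmetroidMatrixDescartes.Census
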